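import Summits.QuantumFields.YangMills.Theorems.UV3UnitPartitionLowerOfPackageV3
import Literature.MathematicalPhysics.QuantumFieldTheory.Balaban1983to89.T3Thresholds
import HarnessLib

/-!
# R-19936-U `stub_unitEnvelope` AS A FACE OVER THE v3 (α) PACKAGE AND ONE DISPLAYED ROW — THE TOP-LEVEL LARGE-FIELD RESUMMATION (leaf B25)

Cell `ym3-torus` (YM ladder rung R3 = continuum `SU(2)` Yang–Mills on the three-torus — a RUNG, NOT d = 4, NOT infinite volume, NOT a mass gap,
NOT Clay).  Width seat `ym3-torus-px12` (gen 12; p1-lineage purpose = the UV3 node of [Balaban1985UV3]); `--supports stmt-QuantumFields-19936 --as helper`,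
count-neutral, definition-free, default heartbeats.  The v3 twin offered by `ym-ust-19936-w8` g11 (bus 2026-08-29 21:50:24Z «a v3 twin (drop `hMain` via
✓p746528) is px12's»), ★★OWNER RECORD 17aq (R-19936-U = (U)-half [the resummation organ at the trivial pin] + (L)-half).

THE POINT.  Over the lane's v3 package `AlphaInputsT3AC.OfV3At F 𝔠 a₀ a₁` the (L)-half of the registered stub `PinnedStability.stub_unitEnvelope` is a tree theorem
(✓`UV3UnitPartitionLowerOfPackageV3.exp_Ecst_le_partitionFn_of_packageV3`, p746528), and the knit «halves ⟹ envelope» is ✓`UV3UnitPartitionLowerOfPackage.unitEnvelope_of_halves`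
(p746059).  THIS FILE types the (U)-half over the same package down to ONE displayed row and assembles the stub's REGISTERED TEXT as a face:
* ★★ `ae_emlDensity_top_le_of_lfTopV3` — (U)-half: `∃ Cu', ∀ K, ∀ᵐ W, ρ_K W ≤ exp(−Ecst K K + Cu')` from (41)_K a.e. (✓`dataT3v3_ineq41AE`), the remainder size
  (✓`dataT3v3_rmSize`), (46) at EVERY history of the top level (✓`PkgAtV3.abs_Pint_succ_le`, no admissibility guard), the weights' sign (✓`OfV3At.wtP_nonneg`), and ONE
  displayed row `hlf`: a K-uniform bound `LF_K(W)[h ↦ −mainT_K(h, W) + Zterm_K(h)] ≤ e^{CZ}` — [Balaban1985UV3] (67)–(71) + [9] §3.C at the top level `k = K` = the END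
  theorem's large-field leaf B25 read at the unit lattice for the AC tower = ★★OWNER RECORD 17aq's «resummation organ at the trivial pin» (R-19936-S's organ, counted once);
  the run `K = 0` needs nothing (`ρ₀ = e^{−β₀A} ≤ 1`, `Ecst 0 0 = 0`).
* ★★★ `stub_unitEnvelope_of_packageV3_of_lfTop` — THE FACE: conclusion = `PinnedStability.stub_unitEnvelope`'s registered text VERBATIM
  (`∀ L, ∃ γ₁ > 0, ∀ F γ, F.L = L → 0 < γ → γ ≤ γ₁ → ∃ Cl, ∀ K, ∀ᵐ V, emlDensity F γ K K V ≤ exp Cl · Z_K`); hypotheses = the v3 socket for every block size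
  (`∃ 𝔠 a₀ a₁` per `L`, transported along `F.L = L` as `AlphaInputsT3AC L` does), a polymer parameter `π F`, and the top-leaf row `hlf` for every package — NOTHING ELSE:
  the two smallness rows of ✓p746528 (`θBal(0) ≤ a₁`, `B₃θBal(0) ≤ a₀`) are DISCHARGED here by the choice of `γ₁` (lit ✓`T3Thresholds.exists_gamma_forall_mul_θBal_le`).

HONEST SCOPE.  Bookkeeping over the v3 package's landed rows; the stub's mathematical weight sits in the DISPLAYED row `hlf` (XL, UV3-node width) and in the socket
(hypothesis schema, the UV3 node's inputs); nothing of them, of `stub_pinnedStep`, of `hP`, of `HistoryTailL` (19936) or of the rung is proved here; this face does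
NOT close the registry row (it is conditional).  Sorry-free, axioms standard.

References: T. Bałaban, Commun. Math. Phys. **102** (1985) 255–275 [Balaban1985UV3] ((1)–(6) pp.256–257, (41) p.266, (46)–(47) p.267, (64) p.273, (67)–(71) pp.273–274);
Commun. Math. Phys. **102** (1985) 277–309 [Balaban1985Variational] (Thm 1 (8) p.279).
-/

set_option autoImplicit false

noncomputable section

namespace Summit.QuantumFields.YangMills.Theorems.UV3UnitEnvelopeFaceOfPackageV3

open MeasureTheory
open scoped BigOperators
open Literature.MathematicalPhysics.QuantumFieldTheory.Balaban1983to89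
open Literature.MathematicalPhysics.QuantumFieldTheory.Balaban1983to89.T3ContinuumYM3Torus
open Literature.MathematicalPhysics.QuantumFieldTheory.Balaban1983to89.T3UnitLawDensityEML (ℰp emlDensity emlDensity_zero)
open Literature.MathematicalPhysics.QuantumFieldTheory.Balaban1983to89.T3UnitScaleTilt (θBal)
open Literature.MathematicalPhysics.QuantumFieldTheory.Balaban1983to89.T3RestrictedUnitDensity (resDensity)
open Literature.MathematicalPhysics.QuantumFieldTheory.Balaban1983to89.T3AlphaInputsAC
open Literature.MathematicalPhysics.QuantumFieldTheory.Balaban1983to89.Missing (boltzmann partitionFn)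
open Literature.MathematicalPhysics.QuantumFieldTheory.Balaban1985CMP102
open Literature.MathematicalPhysics.QuantumFieldTheory.Balaban1985CMP102.Setting
open Summit.QuantumFields.Balaban3D.Carriers
open Summit.QuantumFields.Balaban3D.Proofs.Primitives
open Summit.QuantumFields.YangMills.Theorems.UV3UnitPartitionLowerOfPackage (resDensity_univ_eq unitEnvelope_of_halves)
open Summit.QuantumFields.YangMills.Theorems.UV3UnitPartitionLowerOfPackageV3 (exp_Ecst_le_partitionFn_of_packageV3)

variable {F : T3Family} {𝔠 : AlphaConsts F.L (suGroupModel 2).N} {a₀ a₁ : ℝ}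

/-! ## §1 The (U)-half over the v3 package, down to the top-level large-field leaf -/

/-- ★★ **(U)-HALF: `∃ Cu', ∀ K, ∀ᵐ W, ρ_K W ≤ exp(−Ecst K K + Cu')` MODULO THE v3 PACKAGE AND THE TOP-LEAF ROW `hlf`.**  For `K ≥ 1`: (41)_K a.e.
`ρ_K ≤ e^{−Ecst_K + Rm_K}·LF_K[−mainT + Pint + Zterm]` (✓`dataT3v3_ineq41AE`), `Rm_K ≤ log CRm` (✓`dataT3v3_rmSize`), and inside the history sum `Pint_K(h, W) ≤ CP`
for EVERY history (✓`PkgAtV3.abs_Pint_succ_le`, volume `≤ (2L^m)³`) with non-negative weights (✓`wtP_nonneg`) give `up_K ≤ e^{CP}·LF_K[−mainT + Zterm] ≤ e^{CP + CZ}`;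
for `K = 0`: `ρ₀ = e^{−β₀A} ≤ 1` and `Ecst 0 0 = 0`. [cite: Balaban1985UV3, (41) p.266, (46) p.267, (64) p.273, (67)–(71) pp.273–274] -/
theorem ae_emlDensity_top_le_of_lfTopV3 (h : AlphaInputsT3AC.OfV3At F 𝔠 a₀ a₁) (hc : 0 < a₀ ∧ 0 < a₁ ∧ 𝔠.B₃ * a₁ ≤ a₀)
    (γ : ℝ) (hγ : 0 < γ) (hγ1 : γ ≤ (min 𝔠.gamma0 1) ^ 2) (π : AlphaInputsT3AC.PolymerT3 F)
    (hlf : ∃ CZ : ℝ, ∀ (K : ℕ), 1 ≤ K → ∀ W : GaugeField (F.P K) K (Matrix.specialUnitaryGroup (Fin 2) ℂ),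
      (h.dataT3v3 hc γ hγ hγ1 π).LF K K W
          (fun r => -((h.dataT3v3 hc γ hγ hγ1 π).mainT K K r W) + (h.dataT3v3 hc γ hγ hγ1 π).Zterm K K r) ≤ Real.exp CZ) :
    ∃ Cu' : ℝ, ∀ K : ℕ, ∀ᵐ W ∂fieldMeasure (F.P K) K (Matrix.specialUnitaryGroup (Fin 2) ℂ),
      emlDensity F γ K K W ≤ Real.exp (-((h.dataT3v3 hc γ hγ hγ1 π).Ecst K K) + Cu') := by
  set D := h.dataT3v3 hc γ hγ hγ1 π with hD
  obtain ⟨CZ, hCZ⟩ := hlf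
  -- the remainder: `Rm_K ≤ log CRm`, and `0 ≤ log CRm`
  obtain ⟨CRm, hCRm⟩ := exp_two_Rm_le (h.dataT3v3_rmSize hc γ hγ hγ1 π)
  have hCRm0 : 0 < CRm := (Real.exp_pos _).trans_le (hCRm 0 0 le_rfl)
  have hlog0 : 0 ≤ Real.log CRm := by
    have h0 : 0 ≤ D.Rm 0 0 := Rm_nonneg (h.dataT3v3_rmSize hc γ hγ hγ1 π) le_rfl
    have : (1 : ℝ) ≤ CRm := le_trans (by rw [← Real.exp_zero]; exact Real.exp_le_exp.mpr (by linarith)) (hCRm 0 0 le_rfl)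
    exact Real.log_nonneg this
  have hRm : ∀ K : ℕ, D.Rm K K ≤ Real.log CRm := by
    intro K
    have h0 : 0 ≤ D.Rm K K := Rm_nonneg (h.dataT3v3_rmSize hc γ hγ hγ1 π) le_rfl
    have h2 : Real.exp (2 * D.Rm K K) ≤ CRm := hCRm K K le_rfl
    have h1 : Real.exp (D.Rm K K) ≤ Real.exp (2 * D.Rm K K) := Real.exp_le_exp.mpr (by linarith)
    exact (Real.le_log_iff_exp_le hCRm0).mpr (h1.trans h2)
  -- the interaction sum at the top level, every history: `Pint ≤ CP`, `0 ≤ CP`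
  set CP : ℝ := 𝔠.C46 * (𝔠.M₁ : ℝ) ^ 3 * θBal F.L γ 𝔠.b₀ 𝔠.p₀ 1 ^ 2 * ((2 * F.L ^ F.m : ℕ) : ℝ) ^ 3 with hCPdef
  have hCP0 : 0 ≤ CP := by
    rw [hCPdef]
    exact mul_nonneg (mul_nonneg (mul_nonneg 𝔠.C46_nonneg (pow_nonneg (Nat.cast_nonneg _) _)) (sq_nonneg _))
      (pow_nonneg (Nat.cast_nonneg _) _)
  have hPint : ∀ (K : ℕ), 1 ≤ K → ∀ (r : Hist (F.P K) K) (W : GaugeField (F.P K) K (Matrix.specialUnitaryGroup (Fin 2) ℂ)),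
      D.Pint K K r W ≤ CP := by
    intro K hK r W
    obtain ⟨k, rfl⟩ : ∃ k, K = k + 1 := ⟨K - 1, by omega⟩
    have h46 := (h.pkgAtV3 hc γ hγ hγ1 (k + 1)).abs_Pint_succ_le k le_rfl r W
    have hvol := card_lamFin_le_sitesPerDir_cube (F := F) (K := k + 1) 𝔠.lane.carrier.M₁
      (rcolOf (T3Scales F γ hγ (hγ1.trans (sq_min_one_le _ 𝔠.gamma0_pos)) (k + 1)) 𝔠.lane.carrier) k r
    have hsites : ((F.P (k + 1)).sitesPerDir (k + 1) : ℝ) = ((2 * F.L ^ F.m : ℕ) : ℝ) := by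
      have : (F.P (k + 1)).sitesPerDir (k + 1) = 2 * F.L ^ F.m := by simp [Params.sitesPerDir]
      rw [this]
    have hk : k + 1 - k = 1 := by omega
    rw [hk] at h46
    rw [hsites] at hvol
    have hC : 0 ≤ 𝔠.C46 * (𝔠.M₁ : ℝ) ^ 3 * θBal F.L γ 𝔠.b₀ 𝔠.p₀ 1 ^ 2 :=
      mul_nonneg (mul_nonneg 𝔠.C46_nonneg (pow_nonneg (Nat.cast_nonneg _) _)) (sq_nonneg _)
    have hle := (abs_le.mp h46).2
    show (h.pkgAtV3 hc γ hγ hγ1 (k + 1)).T.Pint (k + 1) r W ≤ CP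
    calc (h.pkgAtV3 hc γ hγ hγ1 (k + 1)).T.Pint (k + 1) r W
        ≤ 𝔠.C46 * (𝔠.M₁ : ℝ) ^ 3 * θBal F.L γ 𝔠.b₀ 𝔠.p₀ 1 ^ 2 *
            ((LamFin 𝔠.lane.carrier.M₁
              (rcolOf (T3Scales F γ hγ (hγ1.trans (sq_min_one_le _ 𝔠.gamma0_pos)) (k + 1)) 𝔠.lane.carrier) k r).card : ℝ) := hle
      _ ≤ 𝔠.C46 * (𝔠.M₁ : ℝ) ^ 3 * θBal F.L γ 𝔠.b₀ 𝔠.p₀ 1 ^ 2 * ((2 * F.L ^ F.m : ℕ) : ℝ) ^ 3 :=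
            mul_le_mul_of_nonneg_left hvol hC
  refine ⟨Real.log CRm + CP + |CZ|, fun K => ?_⟩
  rcases Nat.eq_zero_or_pos K with hK0 | hKpos
  · -- the run K = 0: ρ₀ = e^{−β₀ A} ≤ 1 ≤ e^{Cu'}, Ecst 0 0 = 0
    subst hK0
    have hE : D.Ecst 0 0 = 0 := by
      rw [h.dataT3v3_Ecst_eq hc γ hγ hγ1 π 0 0 le_rfl]
      simp
    refine Filter.Eventually.of_forall fun W => ?_
    rw [hE, neg_zero, zero_add, emlDensity_zero]
    show boltzmann (F.P 0) ((F.scheme ℰp γ).β 0) W ≤ _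
    unfold boltzmann
    refine Real.exp_le_exp.mpr ?_
    have hA : 0 ≤ wilsonAction4 W := wilsonAction4_nonneg W
    have hβ : 0 ≤ (F.scheme ℰp γ).β 0 := F.scheme_β_nonneg ℰp hγ.le 0
    have hCZ0 : 0 ≤ |CZ| := abs_nonneg CZ
    nlinarith [hA, hβ, hlog0, hCP0, hCZ0]
  · have h41 : Ineq41AE D K K := h.dataT3v3_ineq41AE hc γ hγ hγ1 π K K le_rfl
    filter_upwards [h41] with W hW
    rw [← resDensity_univ_eq F γ K K]
    refine hW.trans ?_
    -- `up_K ≤ e^{CP}·LF[−mainT + Zterm] ≤ e^{CP + CZ}`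
    have hup : D.up K K W ≤ Real.exp CP * Real.exp |CZ| := by
      have hLF : D.up K K W = ∑ r : Hist (F.P K) K, (h.pkgAtV3 hc γ hγ hγ1 K).wtP K r W *
          Real.exp (-(D.mainT K K r W) + D.Pint K K r W + D.Zterm K K r) := rfl
      have hLF' : D.LF K K W (fun r => -(D.mainT K K r W) + D.Zterm K K r) =
          ∑ r : Hist (F.P K) K, (h.pkgAtV3 hc γ hγ hγ1 K).wtP K r W * Real.exp (-(D.mainT K K r W) + D.Zterm K K r) := rfl
      rw [hLF]
      calc ∑ r : Hist (F.P K) K, (h.pkgAtV3 hc γ hγ hγ1 K).wtP K r W * Real.exp (-(D.mainT K K r W) + D.Pint K K r W + D.Zterm K K r)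
          ≤ ∑ r : Hist (F.P K) K, (h.pkgAtV3 hc γ hγ hγ1 K).wtP K r W * (Real.exp CP * Real.exp (-(D.mainT K K r W) + D.Zterm K K r)) := by
            refine Finset.sum_le_sum fun r _ => mul_le_mul_of_nonneg_left ?_ (h.wtP_nonneg hc γ hγ hγ1 K K r W)
            rw [← Real.exp_add]
            exact Real.exp_le_exp.mpr (by linarith [hPint K hKpos r W])
        _ = Real.exp CP * D.LF K K W (fun r => -(D.mainT K K r W) + D.Zterm K K r) := by
            rw [hLF', Finset.mul_sum]
            refine Finset.sum_congr rfl fun r _ => by ring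
        _ ≤ Real.exp CP * Real.exp |CZ| :=
            mul_le_mul_of_nonneg_left ((hCZ K hKpos W).trans (Real.exp_le_exp.mpr (le_abs_self CZ))) (Real.exp_pos _).le
    have hup0 : 0 ≤ D.up K K W := by
      have hLF : D.up K K W = ∑ r : Hist (F.P K) K, (h.pkgAtV3 hc γ hγ hγ1 K).wtP K r W *
          Real.exp (-(D.mainT K K r W) + D.Pint K K r W + D.Zterm K K r) := rfl
      rw [hLF]
      exact Finset.sum_nonneg fun r _ => mul_nonneg (h.wtP_nonneg hc γ hγ hγ1 K K r W) (Real.exp_pos _).le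
    calc Real.exp (-(D.Ecst K K) + D.Rm K K) * D.up K K W
        ≤ Real.exp (-(D.Ecst K K) + Real.log CRm) * (Real.exp CP * Real.exp |CZ|) :=
          mul_le_mul (Real.exp_le_exp.mpr (by linarith [hRm K])) hup hup0 (Real.exp_pos _).le
      _ = Real.exp (-(D.Ecst K K) + (Real.log CRm + CP + |CZ|)) := by
          rw [← Real.exp_add, ← Real.exp_add]; ring_nf

/-! ## §2 THE FACE: `stub_unitEnvelope`'s registered text over the v3 socket and the top-leaf row -/

/-- ★★★ **R-19936-U `PinnedStability.stub_unitEnvelope` — ITS REGISTERED TEXT, VERBATIM, FROM THE v3 (α) SOCKET AND ONE DISPLAYED ROW.**  Hypotheses: (i) the v3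
package for every block size `L > 1` — ONE constants record `𝔠 : AlphaConsts L N` and [7] radii `a₀, a₁` (`0 < a₀`, `0 < a₁`, `B₃a₁ ≤ a₀`) serving every family of block size
`L` (transported along `F.L = L`, as `AlphaInputsT3AC L` does); (ii) a polymer parameter `π F`; (iii) the TOP-LEAF ROW `hlf` for every such package: a K-uniform bound on
`LF_K(W)[h ↦ −mainT_K(h, W) + Zterm_K(h)]` ((67)–(71) + [9] §3.C at `k = K` — the END theorem's leaf B25 at the unit lattice for the AC tower; ★★OWNER RECORD 17aq's
«resummation organ at the trivial pin»).  Conclusion: `∀ L, ∃ γ₁ > 0, ∀ F γ, F.L = L → 0 < γ → γ ≤ γ₁ → ∃ Cl, ∀ K, ∀ᵐ V, ρ_K V ≤ e^{Cl}·Z_K`.  Proof: `γ₁ := min (min γ₀ 1)²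
(the two [7]-smallness thresholds of lit ✓`exists_gamma_forall_mul_θBal_le`)`; per `(F, γ)`: (L)-half ✓`exp_Ecst_le_partitionFn_of_packageV3`, (U)-half §1, knit
✓`unitEnvelope_of_halves` at `E K := Ecst K K`.  CONDITIONAL — it does NOT close the registry row. [cite: Balaban1985UV3, (5) p.256, (41) p.266, (47) p.267, (67)–(71) pp.273–274] -/
theorem stub_unitEnvelope_of_packageV3_of_lfTop
    (hpkg : ∀ L : ℕ, 1 < L → ∃ (𝔠 : AlphaConsts L (suGroupModel 2).N) (a₀ a₁ : ℝ),
      (0 < a₀ ∧ 0 < a₁ ∧ 𝔠.B₃ * a₁ ≤ a₀) ∧ ∀ (F : T3Family) (hF : F.L = L), AlphaInputsT3AC.OfV3At F (hF ▸ 𝔠) a₀ a₁)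
    (π : ∀ F : T3Family, AlphaInputsT3AC.PolymerT3 F)
    (hlf : ∀ (F : T3Family) (𝔠 : AlphaConsts F.L (suGroupModel 2).N) (a₀ a₁ : ℝ) (h : AlphaInputsT3AC.OfV3At F 𝔠 a₀ a₁)
      (hc : 0 < a₀ ∧ 0 < a₁ ∧ 𝔠.B₃ * a₁ ≤ a₀) (γ : ℝ) (hγ : 0 < γ) (hγ1 : γ ≤ (min 𝔠.gamma0 1) ^ 2),
      ∃ CZ : ℝ, ∀ (K : ℕ), 1 ≤ K → ∀ W : GaugeField (F.P K) K (Matrix.specialUnitaryGroup (Fin 2) ℂ),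
        (h.dataT3v3 hc γ hγ hγ1 (π F)).LF K K W
            (fun r => -((h.dataT3v3 hc γ hγ hγ1 (π F)).mainT K K r W) + (h.dataT3v3 hc γ hγ hγ1 (π F)).Zterm K K r) ≤
          Real.exp CZ) :
    ∀ (L : ℕ), ∃ γ₁ : ℝ, 0 < γ₁ ∧ ∀ (F : T3Family) (γ : ℝ), F.L = L → 0 < γ → γ ≤ γ₁ →
      ∃ Cl : ℝ, ∀ K : ℕ, ∀ᵐ V ∂(fieldMeasure (F.P K) K (Matrix.specialUnitaryGroup (Fin 2) ℂ)),
        emlDensity F γ K K V ≤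
          Real.exp Cl * partitionFn (G := Matrix.specialUnitaryGroup (Fin 2) ℂ) (F.P K) ((F.scheme ℰp γ).β K) := by
  intro L
  by_cases hL : 1 < L
  · obtain ⟨𝔠, a₀, a₁, hc, hOf⟩ := hpkg L hL
    obtain ⟨γa, hγa, -, ha⟩ := T3Thresholds.exists_gamma_forall_mul_θBal_le (b₀ := 𝔠.b₀) (p₀ := 𝔠.p₀) 𝔠.b₀_pos 𝔠.p₀_pos
      (B := 1) zero_le_one (ε₀ := a₁) hc.2.1
    obtain ⟨γb, hγb, -, hb⟩ := T3Thresholds.exists_gamma_forall_mul_θBal_le (b₀ := 𝔠.b₀) (p₀ := 𝔠.p₀) 𝔠.b₀_pos 𝔠.p₀_pos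
      (B := 𝔠.B₃) 𝔠.B₃_pos.le (ε₀ := a₀) hc.1
    have hγ0 : 0 < (min 𝔠.gamma0 1) ^ 2 := by
      have := 𝔠.gamma0_pos
      positivity
    refine ⟨min ((min 𝔠.gamma0 1) ^ 2) (min γa γb), lt_min hγ0 (lt_min hγa hγb), ?_⟩
    intro F γ hF hγ hγle
    subst hF
    have h : AlphaInputsT3AC.OfV3At F 𝔠 a₀ a₁ := hOf F rfl
    have hγ1 : γ ≤ (min 𝔠.gamma0 1) ^ 2 := hγle.trans (min_le_left _ _)
    have hL1 : 1 ≤ F.L := le_of_lt F.hL.2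
    have ha₁ : θBal F.L γ 𝔠.b₀ 𝔠.p₀ 0 ≤ a₁ := by
      have := ha F.L hL1 γ hγ (hγle.trans ((min_le_right _ _).trans (min_le_left _ _))) 0
      simpa using this
    have ha₀ : 𝔠.B₃ * θBal F.L γ 𝔠.b₀ 𝔠.p₀ 0 ≤ a₀ :=
      hb F.L hL1 γ hγ (hγle.trans ((min_le_right _ _).trans (min_le_right _ _))) 0
    have hL' := exp_Ecst_le_partitionFn_of_packageV3 h hc γ hγ hγ1 (π F) ha₁ ha₀
    have hU' := ae_emlDensity_top_le_of_lfTopV3 h hc γ hγ hγ1 (π F) (hlf F 𝔠 a₀ a₁ h hc γ hγ hγ1)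
    exact unitEnvelope_of_halves F hγ.le (fun K => (h.dataT3v3 hc γ hγ hγ1 (π F)).Ecst K K) hU' hL'
  · -- no three-torus family has block size `L ≤ 1`
    refine ⟨1, one_pos, fun F γ hF _ _ => ?_⟩
    exact absurd (hF ▸ F.hL.2) hL

/-! ## §3 THE №32-CLEAN LETTER (v1.1 append, 2026-08-29): the top-leaf row read `dV`-a.e. -/

/-- ★★ **(U)-HALF WITH THE TOP-LEAF ROW READ A.E.** — §1's `ae_emlDensity_top_le_of_lfTopV3` with `hlf` WEAKENED to `∃ CZ, ∀ K ≥ 1, ∀ᵐ W, LF_K(W)[h ↦ −mainT + Zterm] ≤ e^{CZ}`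
(★★OWNER RULING №32 (1): the masses inside `LF` are Radon–Nikodym versions, so the large-field row is an a.e. statement — R526 hand `ym-ust-19936-w6` g7, bus
2026-08-29 23:11Z; v1-socket twin = `ym-ust-19936-w8` g11's ✓`UV3UnitDensityUpperOfPackage.ae_emlDensity_top_le_of_rows_ae`).  Same proof, one more member of the
`filter_upwards`. [cite: Balaban1985UV3, (41) p.266, (46) p.267, (64) p.273, (67)–(71) pp.273–274] -/
theorem ae_emlDensity_top_le_of_lfTopV3_ae (h : AlphaInputsT3AC.OfV3At F 𝔠 a₀ a₁) (hc : 0 < a₀ ∧ 0 < a₁ ∧ 𝔠.B₃ * a₁ ≤ a₀)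
    (γ : ℝ) (hγ : 0 < γ) (hγ1 : γ ≤ (min 𝔠.gamma0 1) ^ 2) (π : AlphaInputsT3AC.PolymerT3 F)
    (hlf : ∃ CZ : ℝ, ∀ (K : ℕ), 1 ≤ K → ∀ᵐ W ∂fieldMeasure (F.P K) K (Matrix.specialUnitaryGroup (Fin 2) ℂ),
      (h.dataT3v3 hc γ hγ hγ1 π).LF K K W
          (fun r => -((h.dataT3v3 hc γ hγ hγ1 π).mainT K K r W) + (h.dataT3v3 hc γ hγ hγ1 π).Zterm K K r) ≤ Real.exp CZ) :
    ∃ Cu' : ℝ, ∀ K : ℕ, ∀ᵐ W ∂fieldMeasure (F.P K) K (Matrix.specialUnitaryGroup (Fin 2) ℂ),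
      emlDensity F γ K K W ≤ Real.exp (-((h.dataT3v3 hc γ hγ hγ1 π).Ecst K K) + Cu') := by
  set D := h.dataT3v3 hc γ hγ hγ1 π with hD
  obtain ⟨CZ, hCZ⟩ := hlf
  -- the remainder: `Rm_K ≤ log CRm`, and `0 ≤ log CRm`
  obtain ⟨CRm, hCRm⟩ := exp_two_Rm_le (h.dataT3v3_rmSize hc γ hγ hγ1 π)
  have hCRm0 : 0 < CRm := (Real.exp_pos _).trans_le (hCRm 0 0 le_rfl)
  have hlog0 : 0 ≤ Real.log CRm := by
    have h0 : 0 ≤ D.Rm 0 0 := Rm_nonneg (h.dataT3v3_rmSize hc γ hγ hγ1 π) le_rfl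
    have : (1 : ℝ) ≤ CRm := le_trans (by rw [← Real.exp_zero]; exact Real.exp_le_exp.mpr (by linarith)) (hCRm 0 0 le_rfl)
    exact Real.log_nonneg this
  have hRm : ∀ K : ℕ, D.Rm K K ≤ Real.log CRm := by
    intro K
    have h0 : 0 ≤ D.Rm K K := Rm_nonneg (h.dataT3v3_rmSize hc γ hγ hγ1 π) le_rfl
    have h2 : Real.exp (2 * D.Rm K K) ≤ CRm := hCRm K K le_rfl
    have h1 : Real.exp (D.Rm K K) ≤ Real.exp (2 * D.Rm K K) := Real.exp_le_exp.mpr (by linarith)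
    exact (Real.le_log_iff_exp_le hCRm0).mpr (h1.trans h2)
  -- the interaction sum at the top level, every history: `Pint ≤ CP`, `0 ≤ CP`
  set CP : ℝ := 𝔠.C46 * (𝔠.M₁ : ℝ) ^ 3 * θBal F.L γ 𝔠.b₀ 𝔠.p₀ 1 ^ 2 * ((2 * F.L ^ F.m : ℕ) : ℝ) ^ 3 with hCPdef
  have hCP0 : 0 ≤ CP := by
    rw [hCPdef]
    exact mul_nonneg (mul_nonneg (mul_nonneg 𝔠.C46_nonneg (pow_nonneg (Nat.cast_nonneg _) _)) (sq_nonneg _))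
      (pow_nonneg (Nat.cast_nonneg _) _)
  have hPint : ∀ (K : ℕ), 1 ≤ K → ∀ (r : Hist (F.P K) K) (W : GaugeField (F.P K) K (Matrix.specialUnitaryGroup (Fin 2) ℂ)),
      D.Pint K K r W ≤ CP := by
    intro K hK r W
    obtain ⟨k, rfl⟩ : ∃ k, K = k + 1 := ⟨K - 1, by omega⟩
    have h46 := (h.pkgAtV3 hc γ hγ hγ1 (k + 1)).abs_Pint_succ_le k le_rfl r W
    have hvol := card_lamFin_le_sitesPerDir_cube (F := F) (K := k + 1) 𝔠.lane.carrier.M₁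
      (rcolOf (T3Scales F γ hγ (hγ1.trans (sq_min_one_le _ 𝔠.gamma0_pos)) (k + 1)) 𝔠.lane.carrier) k r
    have hsites : ((F.P (k + 1)).sitesPerDir (k + 1) : ℝ) = ((2 * F.L ^ F.m : ℕ) : ℝ) := by
      have : (F.P (k + 1)).sitesPerDir (k + 1) = 2 * F.L ^ F.m := by simp [Params.sitesPerDir]
      rw [this]
    have hk : k + 1 - k = 1 := by omega
    rw [hk] at h46
    rw [hsites] at hvol
    have hC : 0 ≤ 𝔠.C46 * (𝔠.M₁ : ℝ) ^ 3 * θBal F.L γ 𝔠.b₀ 𝔠.p₀ 1 ^ 2 :=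
      mul_nonneg (mul_nonneg 𝔠.C46_nonneg (pow_nonneg (Nat.cast_nonneg _) _)) (sq_nonneg _)
    have hle := (abs_le.mp h46).2
    show (h.pkgAtV3 hc γ hγ hγ1 (k + 1)).T.Pint (k + 1) r W ≤ CP
    calc (h.pkgAtV3 hc γ hγ hγ1 (k + 1)).T.Pint (k + 1) r W
        ≤ 𝔠.C46 * (𝔠.M₁ : ℝ) ^ 3 * θBal F.L γ 𝔠.b₀ 𝔠.p₀ 1 ^ 2 *
            ((LamFin 𝔠.lane.carrier.M₁
              (rcolOf (T3Scales F γ hγ (hγ1.trans (sq_min_one_le _ 𝔠.gamma0_pos)) (k + 1)) 𝔠.lane.carrier) k r).card : ℝ) := hle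
      _ ≤ 𝔠.C46 * (𝔠.M₁ : ℝ) ^ 3 * θBal F.L γ 𝔠.b₀ 𝔠.p₀ 1 ^ 2 * ((2 * F.L ^ F.m : ℕ) : ℝ) ^ 3 :=
            mul_le_mul_of_nonneg_left hvol hC
  refine ⟨Real.log CRm + CP + |CZ|, fun K => ?_⟩
  rcases Nat.eq_zero_or_pos K with hK0 | hKpos
  · -- the run K = 0: ρ₀ = e^{−β₀ A} ≤ 1 ≤ e^{Cu'}, Ecst 0 0 = 0
    subst hK0
    have hE : D.Ecst 0 0 = 0 := by
      rw [h.dataT3v3_Ecst_eq hc γ hγ hγ1 π 0 0 le_rfl]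
      simp
    refine Filter.Eventually.of_forall fun W => ?_
    rw [hE, neg_zero, zero_add, emlDensity_zero]
    show boltzmann (F.P 0) ((F.scheme ℰp γ).β 0) W ≤ _
    unfold boltzmann
    refine Real.exp_le_exp.mpr ?_
    have hA : 0 ≤ wilsonAction4 W := wilsonAction4_nonneg W
    have hβ : 0 ≤ (F.scheme ℰp γ).β 0 := F.scheme_β_nonneg ℰp hγ.le 0
    have hCZ0 : 0 ≤ |CZ| := abs_nonneg CZ
    nlinarith [hA, hβ, hlog0, hCP0, hCZ0]
  · have h41 : Ineq41AE D K K := h.dataT3v3_ineq41AE hc γ hγ hγ1 π K K le_rfl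
    filter_upwards [h41, hCZ K hKpos] with W hW hWZ
    rw [← resDensity_univ_eq F γ K K]
    refine hW.trans ?_
    -- `up_K ≤ e^{CP}·LF[−mainT + Zterm] ≤ e^{CP + CZ}`
    have hup : D.up K K W ≤ Real.exp CP * Real.exp |CZ| := by
      have hLF : D.up K K W = ∑ r : Hist (F.P K) K, (h.pkgAtV3 hc γ hγ hγ1 K).wtP K r W *
          Real.exp (-(D.mainT K K r W) + D.Pint K K r W + D.Zterm K K r) := rfl
      have hLF' : D.LF K K W (fun r => -(D.mainT K K r W) + D.Zterm K K r) =
          ∑ r : Hist (F.P K) K, (h.pkgAtV3 hc γ hγ hγ1 K).wtP K r W * Real.exp (-(D.mainT K K r W) + D.Zterm K K r) := rfl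
      rw [hLF]
      calc ∑ r : Hist (F.P K) K, (h.pkgAtV3 hc γ hγ hγ1 K).wtP K r W * Real.exp (-(D.mainT K K r W) + D.Pint K K r W + D.Zterm K K r)
          ≤ ∑ r : Hist (F.P K) K, (h.pkgAtV3 hc γ hγ hγ1 K).wtP K r W * (Real.exp CP * Real.exp (-(D.mainT K K r W) + D.Zterm K K r)) := by
            refine Finset.sum_le_sum fun r _ => mul_le_mul_of_nonneg_left ?_ (h.wtP_nonneg hc γ hγ hγ1 K K r W)
            rw [← Real.exp_add]
            exact Real.exp_le_exp.mpr (by linarith [hPint K hKpos r W])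
        _ = Real.exp CP * D.LF K K W (fun r => -(D.mainT K K r W) + D.Zterm K K r) := by
            rw [hLF', Finset.mul_sum]
            refine Finset.sum_congr rfl fun r _ => by ring
        _ ≤ Real.exp CP * Real.exp |CZ| :=
            mul_le_mul_of_nonneg_left (hWZ.trans (Real.exp_le_exp.mpr (le_abs_self CZ))) (Real.exp_pos _).le
    have hup0 : 0 ≤ D.up K K W := by
      have hLF : D.up K K W = ∑ r : Hist (F.P K) K, (h.pkgAtV3 hc γ hγ hγ1 K).wtP K r W *
          Real.exp (-(D.mainT K K r W) + D.Pint K K r W + D.Zterm K K r) := rfl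
      rw [hLF]
      exact Finset.sum_nonneg fun r _ => mul_nonneg (h.wtP_nonneg hc γ hγ hγ1 K K r W) (Real.exp_pos _).le
    calc Real.exp (-(D.Ecst K K) + D.Rm K K) * D.up K K W
        ≤ Real.exp (-(D.Ecst K K) + Real.log CRm) * (Real.exp CP * Real.exp |CZ|) :=
          mul_le_mul (Real.exp_le_exp.mpr (by linarith [hRm K])) hup hup0 (Real.exp_pos _).le
      _ = Real.exp (-(D.Ecst K K) + (Real.log CRm + CP + |CZ|)) := by
          rw [← Real.exp_add, ← Real.exp_add]; ring_nf

/-- ★★★ **R-19936-U `PinnedStability.stub_unitEnvelope` — ITS REGISTERED TEXT, VERBATIM, FROM THE v3 (α) SOCKET AND THE TOP-LEAF ROW READ A.E.** — §2's face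
`stub_unitEnvelope_of_packageV3_of_lfTop` in the №32-clean letter: hypothesis (iii) `hlf` now quantifies `∀ K ≥ 1, ∀ᵐ W ∂fieldMeasure (F.P K) K SU(2)`; (i) the v3 socket per
block size and (ii) the polymer parameter unchanged; conclusion = the registered text (295 chars) unchanged.  CONDITIONAL — it does NOT close the registry row.
[cite: Balaban1985UV3, (5) p.256, (41) p.266, (47) p.267, (67)–(71) pp.273–274] -/
theorem stub_unitEnvelope_of_packageV3_of_lfTop_ae
    (hpkg : ∀ L : ℕ, 1 < L → ∃ (𝔠 : AlphaConsts L (suGroupModel 2).N) (a₀ a₁ : ℝ),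
      (0 < a₀ ∧ 0 < a₁ ∧ 𝔠.B₃ * a₁ ≤ a₀) ∧ ∀ (F : T3Family) (hF : F.L = L), AlphaInputsT3AC.OfV3At F (hF ▸ 𝔠) a₀ a₁)
    (π : ∀ F : T3Family, AlphaInputsT3AC.PolymerT3 F)
    (hlf : ∀ (F : T3Family) (𝔠 : AlphaConsts F.L (suGroupModel 2).N) (a₀ a₁ : ℝ) (h : AlphaInputsT3AC.OfV3At F 𝔠 a₀ a₁)
      (hc : 0 < a₀ ∧ 0 < a₁ ∧ 𝔠.B₃ * a₁ ≤ a₀) (γ : ℝ) (hγ : 0 < γ) (hγ1 : γ ≤ (min 𝔠.gamma0 1) ^ 2),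
      ∃ CZ : ℝ, ∀ (K : ℕ), 1 ≤ K → ∀ᵐ W ∂fieldMeasure (F.P K) K (Matrix.specialUnitaryGroup (Fin 2) ℂ),
        (h.dataT3v3 hc γ hγ hγ1 (π F)).LF K K W
            (fun r => -((h.dataT3v3 hc γ hγ hγ1 (π F)).mainT K K r W) + (h.dataT3v3 hc γ hγ hγ1 (π F)).Zterm K K r) ≤
          Real.exp CZ) :
    ∀ (L : ℕ), ∃ γ₁ : ℝ, 0 < γ₁ ∧ ∀ (F : T3Family) (γ : ℝ), F.L = L → 0 < γ → γ ≤ γ₁ →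
      ∃ Cl : ℝ, ∀ K : ℕ, ∀ᵐ V ∂(fieldMeasure (F.P K) K (Matrix.specialUnitaryGroup (Fin 2) ℂ)),
        emlDensity F γ K K V ≤
          Real.exp Cl * partitionFn (G := Matrix.specialUnitaryGroup (Fin 2) ℂ) (F.P K) ((F.scheme ℰp γ).β K) := by
  intro L
  by_cases hL : 1 < L
  · obtain ⟨𝔠, a₀, a₁, hc, hOf⟩ := hpkg L hL
    obtain ⟨γa, hγa, -, ha⟩ := T3Thresholds.exists_gamma_forall_mul_θBal_le (b₀ := 𝔠.b₀) (p₀ := 𝔠.p₀) 𝔠.b₀_pos 𝔠.p₀_pos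
      (B := 1) zero_le_one (ε₀ := a₁) hc.2.1
    obtain ⟨γb, hγb, -, hb⟩ := T3Thresholds.exists_gamma_forall_mul_θBal_le (b₀ := 𝔠.b₀) (p₀ := 𝔠.p₀) 𝔠.b₀_pos 𝔠.p₀_pos
      (B := 𝔠.B₃) 𝔠.B₃_pos.le (ε₀ := a₀) hc.1
    have hγ0 : 0 < (min 𝔠.gamma0 1) ^ 2 := by
      have := 𝔠.gamma0_pos
      positivity
    refine ⟨min ((min 𝔠.gamma0 1) ^ 2) (min γa γb), lt_min hγ0 (lt_min hγa hγb), ?_⟩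
    intro F γ hF hγ hγle
    subst hF
    have h : AlphaInputsT3AC.OfV3At F 𝔠 a₀ a₁ := hOf F rfl
    have hγ1 : γ ≤ (min 𝔠.gamma0 1) ^ 2 := hγle.trans (min_le_left _ _)
    have hL1 : 1 ≤ F.L := le_of_lt F.hL.2
    have ha₁ : θBal F.L γ 𝔠.b₀ 𝔠.p₀ 0 ≤ a₁ := by
      have := ha F.L hL1 γ hγ (hγle.trans ((min_le_right _ _).trans (min_le_left _ _))) 0
      simpa using this
    have ha₀ : 𝔠.B₃ * θBal F.L γ 𝔠.b₀ 𝔠.p₀ 0 ≤ a₀ :=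
      hb F.L hL1 γ hγ (hγle.trans ((min_le_right _ _).trans (min_le_right _ _))) 0
    have hL' := exp_Ecst_le_partitionFn_of_packageV3 h hc γ hγ hγ1 (π F) ha₁ ha₀
    have hU' := ae_emlDensity_top_le_of_lfTopV3_ae h hc γ hγ hγ1 (π F) (hlf F 𝔠 a₀ a₁ h hc γ hγ hγ1)
    exact unitEnvelope_of_halves F hγ.le (fun K => (h.dataT3v3 hc γ hγ hγ1 (π F)).Ecst K K) hU' hL'
  · -- no three-torus family has block size `L ≤ 1`
    refine ⟨1, one_pos, fun F γ hF _ _ => ?_⟩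
    exact absurd (hF ▸ F.hL.2) hL

end Summit.QuantumFields.YangMills.Theorems.UV3UnitEnvelopeFaceOfPackageV3

end
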